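import Summits.Parity.GeneralizedHardyLittlewood.Theses.LiouvilleShiftedTables
import Literature.NumberTheory.Sieve.LevelOfDistributionProofs

/-!
# `EH` (crux `stmt-Parity-11314`, routes `LiouvilleShiftedTables` / `LiouvilleMAD` /
# `RoughSemiprimeRigidity`): the trivial floor of the Elliott–Halberstam sum and what it kills
# (negative-side support, file 1 of 3)

Support file of the crux disprover (cdisprove seat), `sorry`-free.  The crux
`Summit.Parity.GeneralizedHardyLittlewood.Theses.LiouvilleShiftedTables.EH` is `Iff.rfl`-equal to
`Literature.NumberTheory.Sieve.LevelOfDistribution.ElliottHalberstam = ∀ θ < 1, PrimesHaveLevel θ`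
(max over `1 ≤ y ≤ x` and over reduced classes).  No theorem here asserts `EH` or any route item.

* §1 the floor `E*(x; q) ≥ 1` for `2 ≤ q ≤ x + 1` (`y = q − 1`, `a = 1`, `ψ(q−1; q, 1) = Λ(1) = 0`),
  hence `∑_{q ≤ Q} E*(x; q) ≥ Q − 1` for `Q ≤ ⌊x⌋ + 1`; and the growth lemma "eventually `≥ c x` is not
  `O(x/(log x)^A)`";
* §3 the open endpoint `θ − ε < 1` IS load-bearing: level `x^η`, `η ≥ 1`, fails for every `A > 0`
  (`η = 1` new, `η > 1` = the tree's `not_primesHaveLevel_of_one_lt`); `EH` without `θ < 1`, without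
  `0 < ε`, or in the `ε`-free form with the CLOSED endpoint `θ ≤ 1` is false — whereas the `ε`-free
  form with `θ < 1` is `EH` itself (file 3, `eh_iff_exactLevel`);
* §5 natural strengthenings refuted by the floor alone: level `x/(log x)^B` with saving `(log x)^{-A}`,
  `A > B ≥ 0` (so the honest log-level statement is the `∀ A ∃ B(A)` shape refuted by
  Friedlander–Granville 1989, not available in the tree); a UNIFORM power saving
  `∃ δ > 0 ∀ θ < 1, ≪ x^{1−δ}` (the pointwise `∀ θ ∃ δ`, Montgomery's shape, is untouched).
[cite: FriedlanderGranville1989] [cite: Polymath8b2014, Claim 2.2]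
-/

open Filter Asymptotics Finset
open Literature.NumberTheory.Sieve

namespace Summit.Parity.GeneralizedHardyLittlewood.Theorems.EH.Negative

open Summit.Parity.GeneralizedHardyLittlewood.Theses.LiouvilleShiftedTables (EH)

/-! ### §1 The trivial floor `E*(x; q) ≥ 1` -/

/-- For `2 ≤ q ≤ x + 1`, `E*(x; q) ≥ 1`: at height `y = q - 1 ∈ [1, x]` and class `a = 1` one has
`ψ(q - 1; q, 1) = Λ(1) = 0`, so the error is `(q-1)/φ(q) ≥ 1`. [folklore] -/
theorem one_le_primeAPError {x : ℝ} {q : ℕ} (hq : 2 ≤ q) (hqx : (q : ℝ) - 1 ≤ x) :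
    1 ≤ primeAPError x q := by
  have hq0 : q ≠ 0 := by omega
  haveI : NeZero q := ⟨hq0⟩
  have hy1 : (1 : ℝ) ≤ (q : ℝ) - 1 := by
    have : (2 : ℝ) ≤ q := by exact_mod_cast hq
    linarith
  have key := abs_sub_le_primeAPError (x := x) hq0 hy1 hqx 1
  have hfl : ⌊(q : ℝ) - 1⌋₊ = q - 1 := by
    rw [show (q : ℝ) - 1 = ((q - 1 : ℕ) : ℝ) by push_cast [Nat.cast_sub (by omega : 1 ≤ q)]; ring]
    exact Nat.floor_natCast _
  rw [Units.val_one, chebyshevPsiMod_one_eq_zero (by rw [hfl]; omega) (by omega), zero_sub,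
    abs_neg] at key
  refine le_trans ?_ ((le_abs_self _).trans key)
  have hφpos : (0 : ℝ) < Nat.totient q := by exact_mod_cast Nat.totient_pos.mpr (by omega)
  have hφ : (Nat.totient q : ℝ) ≤ (q : ℝ) - 1 := by
    have h1 : Nat.totient q ≤ q - 1 := Nat.le_sub_one_of_lt (Nat.totient_lt q (by omega))
    have h2 : ((q - 1 : ℕ) : ℝ) = (q : ℝ) - 1 := by push_cast [Nat.cast_sub (by omega : 1 ≤ q)]; ring
    rw [← h2]; exact_mod_cast h1
  rw [le_div_iff₀ hφpos, one_mul]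
  exact hφ

/-- Summing the floor: for `Q ≤ ⌊x⌋ + 1`, `∑_{q ≤ Q} E*(x; q) ≥ Q - 1`. [folklore] -/
theorem sub_one_le_sum_primeAPError (x : ℝ) {Q : ℕ} (hQ : Q ≤ ⌊x⌋₊ + 1) :
    (Q : ℝ) - 1 ≤ ∑ q ∈ Icc 1 Q, primeAPError x q := by
  rcases Nat.eq_zero_or_pos Q with hQ0 | hQpos
  · subst hQ0
    simp
  have hsub : Icc 2 Q ⊆ Icc 1 Q := Icc_subset_Icc (by norm_num) le_rfl
  calc (Q : ℝ) - 1 = ∑ q ∈ Icc 2 Q, (1 : ℝ) := by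
        rw [sum_const, Nat.card_Icc, nsmul_eq_mul, mul_one]
        rw [show Q + 1 - 2 = Q - 1 by omega]
        push_cast [Nat.cast_sub hQpos]; ring
    _ ≤ ∑ q ∈ Icc 2 Q, primeAPError x q := by
        refine sum_le_sum fun q hq => ?_
        rw [mem_Icc] at hq
        have hfl1 : 1 ≤ ⌊x⌋₊ := by omega
        have hx1 : (1 : ℝ) ≤ x := by
          by_contra h
          rw [not_le] at h
          have : ⌊x⌋₊ = 0 := Nat.floor_eq_zero.mpr h
          omega
        refine one_le_primeAPError hq.1 ?_
        have h1 : ((q - 1 : ℕ) : ℝ) ≤ ⌊x⌋₊ := by exact_mod_cast (by omega : q - 1 ≤ ⌊x⌋₊)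
        have h2 : ((⌊x⌋₊ : ℕ) : ℝ) ≤ x := Nat.floor_le (by linarith)
        have h3 : ((q - 1 : ℕ) : ℝ) = (q : ℝ) - 1 := by push_cast [Nat.cast_sub (by omega : 1 ≤ q)]; ring
        linarith
    _ ≤ ∑ q ∈ Icc 1 Q, primeAPError x q :=
        sum_le_sum_of_subset_of_nonneg hsub fun q _ _ => primeAPError_nonneg x q

/-- Master growth lemma: a function eventually `≥ c·x` (`c > 0`) is not `O(x/(log x)^A)` for any
`A > 0`. [folklore] -/
theorem not_isBigO_div_log_rpow {f : ℝ → ℝ} {c A : ℝ} (hc : 0 < c) (hA : 0 < A)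
    (hf : ∀ᶠ x in atTop, c * x ≤ f x) :
    ¬ f =O[atTop] fun x : ℝ => x / Real.log x ^ A := by
  intro h
  obtain ⟨C, hC0, hC⟩ := h.exists_pos
  have hlog : Tendsto (fun x : ℝ => Real.log x ^ A) atTop atTop :=
    (tendsto_rpow_atTop hA).comp Real.tendsto_log_atTop
  obtain ⟨x, hfx, hbd, hbig, hx3⟩ :=
    (hf.and (hC.bound.and ((hlog.eventually_ge_atTop (2 * C / c)).and
      (eventually_ge_atTop 3)))).exists
  have hx0 : 0 < x := by linarith
  have hlogpos : 0 < Real.log x := Real.log_pos (by linarith)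
  set L := Real.log x ^ A with hL
  have hLpos : 0 < L := Real.rpow_pos_of_pos hlogpos A
  rw [Real.norm_eq_abs, Real.norm_eq_abs, abs_of_nonneg (div_nonneg hx0.le hLpos.le)] at hbd
  have h1 : c * x ≤ C * (x / L) := hfx.trans ((le_abs_self _).trans hbd)
  rw [mul_div_assoc', le_div_iff₀ hLpos] at h1
  have h2 : c * L * x ≤ C * x := by linarith
  have h3 : c * L ≤ C := le_of_mul_le_mul_right h2 hx0
  have h4 : 2 * C / c ≤ L := hbig
  rw [div_le_iff₀ hc] at h4
  nlinarith

/-! ### §3 Load-bearing: the open endpoint `θ - ε < 1` -/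

/-- **Level `x^η` with `η ≥ 1` fails for every `A > 0`** (for `η > 1` this is the tree's
`not_primesHaveLevel_of_one_lt`; the endpoint `η = 1`, level exactly `x`, is new here and equally
trivial): `∑_{q ≤ x} E*(x; q) ≥ ⌊x⌋ - 1` by the floor `E*(x; q) ≥ 1`. [folklore] -/
theorem not_isBigO_levelSum_of_one_le {η A : ℝ} (hη : 1 ≤ η) (hA : 0 < A) :
    ¬ (fun x : ℝ => ∑ q ∈ Icc 1 ⌊x ^ η⌋₊, primeAPError x q) =O[atTop]
        fun x : ℝ => x / Real.log x ^ A := by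
  refine not_isBigO_div_log_rpow (c := 1 / 2) (by norm_num) hA ?_
  filter_upwards [eventually_ge_atTop (4 : ℝ)] with x hx
  have hx0 : 0 ≤ x := by linarith
  have hx1 : 1 ≤ x := by linarith
  have hsub : Icc 1 ⌊x⌋₊ ⊆ Icc 1 ⌊x ^ η⌋₊ := by
    refine Icc_subset_Icc le_rfl (Nat.floor_le_floor ?_)
    simpa using Real.rpow_le_rpow_of_exponent_le hx1 hη
  have h1 : (⌊x⌋₊ : ℝ) - 1 ≤ ∑ q ∈ Icc 1 ⌊x⌋₊, primeAPError x q :=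
    sub_one_le_sum_primeAPError x (Nat.le_succ _)
  have h2 : x - 1 < (⌊x⌋₊ : ℝ) := by
    have := Nat.lt_floor_add_one x
    linarith
  calc 1 / 2 * x ≤ (⌊x⌋₊ : ℝ) - 1 := by linarith
    _ ≤ ∑ q ∈ Icc 1 ⌊x⌋₊, primeAPError x q := h1
    _ ≤ ∑ q ∈ Icc 1 ⌊x ^ η⌋₊, primeAPError x q :=
        sum_le_sum_of_subset_of_nonneg hsub fun q _ _ => primeAPError_nonneg x q

/-- **Any proof must use `θ < 1`** (`EH` with the hypothesis `θ < 1` dropped is false):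
witness `θ = 2`, `ε = 1`, `A = 1` (level `x`). [folklore] -/
theorem eh_false_without_thetaLtOne :
    ¬ ∀ θ : ℝ, ∀ A : ℝ, 0 < A → ∀ ε : ℝ, 0 < ε →
      (fun x : ℝ => ∑ q ∈ Icc 1 ⌊x ^ (θ - ε)⌋₊, primeAPError x q) =O[atTop]
        fun x : ℝ => x / Real.log x ^ A := fun h =>
  not_isBigO_levelSum_of_one_le (η := 2 - 1) (by norm_num) one_pos (h 2 1 one_pos 1 one_pos)

/-- **Any proof must use `0 < ε`**, more precisely `θ - ε < 1` (`EH` with `0 < ε` dropped is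
false): witness `θ = 0`, `ε = -1` (level `x`). [folklore] -/
theorem eh_false_without_epsPos :
    ¬ ∀ θ : ℝ, θ < 1 → ∀ A : ℝ, 0 < A → ∀ ε : ℝ,
      (fun x : ℝ => ∑ q ∈ Icc 1 ⌊x ^ (θ - ε)⌋₊, primeAPError x q) =O[atTop]
        fun x : ℝ => x / Real.log x ^ A := fun h =>
  not_isBigO_levelSum_of_one_le (η := 0 - (-1)) (by norm_num) one_pos
    (h 0 (by norm_num) 1 one_pos (-1))

/-- **The `ε`-free form with the CLOSED endpoint `θ ≤ 1` is false**, while with the open endpoint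
`θ < 1` it is `EH` itself (`eh_iff_exactLevel`): the only thing separating the conjecture from a
trivially false statement is `θ < 1` versus `θ ≤ 1` (tightness of the exponent `1`). [folklore] -/
theorem eh_false_at_closedEndpoint :
    ¬ ∀ θ : ℝ, θ ≤ 1 → ∀ A : ℝ, 0 < A →
      (fun x : ℝ => ∑ q ∈ Icc 1 ⌊x ^ θ⌋₊, primeAPError x q) =O[atTop]
        fun x : ℝ => x / Real.log x ^ A := fun h =>
  not_isBigO_levelSum_of_one_le (η := 1) le_rfl one_pos (by simpa using h 1 le_rfl 1 one_pos)

/-! ### §5 Natural strengthenings refuted -/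

/-- **Log-power level, naive form, is trivially false**: for `0 ≤ B < A` the level
`x/(log x)^B` sum is `≥ x/(log x)^B - 2`, not `O(x/(log x)^A)`.  So in the max-over-`y ≥ 1`
normalisation "level `x(log x)^{-B}` for every `A`" is false for the floor alone; the honest
log-level statement is the Bombieri–Vinogradov shape `∀ A ∃ B = B(A)`, refuted by
Friedlander–Granville 1989 (Ann. of Math. 129) — a deep theorem NOT available in the tree (the tree's
`FriedlanderGranvilleUniformityBarrier_holds` is the pointwise part III, `Q^{1-1/log log Q}` bad
moduli, too sparse to contradict an average). [folklore] -/
theorem not_isBigO_logLevel {A B : ℝ} (hB : 0 ≤ B) (hBA : B < A) :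
    ¬ (fun x : ℝ => ∑ q ∈ Icc 1 ⌊x / Real.log x ^ B⌋₊, primeAPError x q) =O[atTop]
        fun x : ℝ => x / Real.log x ^ A := by
  intro h
  obtain ⟨C, hC0, hC⟩ := h.exists_pos
  have hlog : Tendsto (fun x : ℝ => Real.log x ^ (A - B)) atTop atTop :=
    (tendsto_rpow_atTop (by linarith)).comp Real.tendsto_log_atTop
  have hlow : ∀ᶠ x : ℝ in atTop, (3 : ℝ) ≤ x / Real.log x ^ A := by
    filter_upwards [rpow_mul_log_le_div_eventually one_half_pos A,
      (tendsto_rpow_atTop (by norm_num : (0 : ℝ) < 1 - 1 / 2)).eventually_ge_atTop 3,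
      eventually_ge_atTop (3 : ℝ)] with x hx hx3 hx3'
    have hlog1 : 1 ≤ Real.log x := one_le_log_of_three_le hx3'
    have hx0 : 0 ≤ x ^ (1 - 1 / 2 : ℝ) := Real.rpow_nonneg (by linarith) _
    calc (3 : ℝ) ≤ x ^ (1 - 1 / 2 : ℝ) := hx3
      _ ≤ x ^ (1 - 1 / 2 : ℝ) * Real.log x := le_mul_of_one_le_right hx0 hlog1
      _ ≤ x / Real.log x ^ A := hx
  obtain ⟨x, hbd, hbig, h3, hx3⟩ :=
    (hC.bound.and ((hlog.eventually_ge_atTop (C + 1)).and (hlow.and (eventually_ge_atTop 3)))).exists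
  have hx0 : 0 < x := by linarith
  have hlogpos : 0 < Real.log x := Real.log_pos (by linarith)
  have hLA : 0 < Real.log x ^ A := Real.rpow_pos_of_pos hlogpos A
  have hLB : 0 < Real.log x ^ B := Real.rpow_pos_of_pos hlogpos B
  -- the level is at most `x + 1`
  have hlev : ⌊x / Real.log x ^ B⌋₊ ≤ ⌊x⌋₊ + 1 := by
    refine (Nat.floor_le_floor ?_).trans (Nat.le_succ _)
    exact div_le_self hx0.le (Real.one_le_rpow (one_le_log_of_three_le hx3) hB)
  have h1 := sub_one_le_sum_primeAPError x hlev
  rw [Real.norm_eq_abs, Real.norm_eq_abs, abs_of_nonneg (div_nonneg hx0.le hLA.le),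
    abs_of_nonneg (sum_nonneg fun q _ => primeAPError_nonneg x q)] at hbd
  have h2 : x / Real.log x ^ B - 2 ≤ C * (x / Real.log x ^ A) := by
    have := Nat.lt_floor_add_one (x / Real.log x ^ B)
    linarith
  -- `x/(log x)^B = (x/(log x)^A) · (log x)^{A-B} ≥ (C+1) · x/(log x)^A`
  have h4 : x / Real.log x ^ B = x / Real.log x ^ A * Real.log x ^ (A - B) := by
    have hA' := hLA.ne'
    have hB' := hLB.ne'
    rw [Real.rpow_sub hlogpos]
    field_simp
  have h5 : (C + 1) * (x / Real.log x ^ A) ≤ x / Real.log x ^ B := by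
    rw [h4, mul_comm]
    exact mul_le_mul_of_nonneg_left hbig (div_nonneg hx0.le hLA.le)
  nlinarith

/-- Corollary: "level `x(log x)^{-B}` for every `A > 0`" is false for every `B ≥ 0`. [folklore] -/
theorem not_logLevel_forall_A {B : ℝ} (hB : 0 ≤ B) :
    ¬ ∀ A : ℝ, 0 < A → (fun x : ℝ => ∑ q ∈ Icc 1 ⌊x / Real.log x ^ B⌋₊, primeAPError x q) =O[atTop]
        fun x : ℝ => x / Real.log x ^ A := fun h =>
  not_isBigO_logLevel hB (by linarith : B < B + 1) (h (B + 1) (by linarith))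

/-- **Power saving is capped by the level**: for `0 < δ < 1` and `1 - δ < θ ≤ 1`,
`∑_{q ≤ x^θ} E*(x; q)` is not `O(x^{1-δ})` (floor: the sum is `≥ x^θ - 2`).  Hence the UNIFORM
power-saving strengthening `∃ δ > 0, ∀ θ < 1, ∑_{q ≤ x^θ} E* ≪ x^{1-δ}` is false
(`not_uniformPowerSaving`), while the pointwise one `∀ θ < 1, ∃ δ > 0, …` (Montgomery's conjecture
shape, `δ < (1-θ)/2`) is untouched. [folklore] -/
theorem not_isBigO_powerSaving {θ δ : ℝ} (hδ0 : 0 < δ) (hδ1 : δ < 1) (hθ : 1 - δ < θ) (hθ1 : θ ≤ 1) :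
    ¬ (fun x : ℝ => ∑ q ∈ Icc 1 ⌊x ^ θ⌋₊, primeAPError x q) =O[atTop] fun x : ℝ => x ^ (1 - δ) := by
  intro h
  obtain ⟨C, hC0, hC⟩ := h.exists_pos
  have hκ : 0 < θ - (1 - δ) := by linarith
  obtain ⟨x, hbd, hbig, h3, hx1⟩ :=
    (hC.bound.and (((tendsto_rpow_atTop hκ).eventually_ge_atTop (C + 1)).and
      (((tendsto_rpow_atTop (by linarith : 0 < 1 - δ)).eventually_ge_atTop 3).and
        (eventually_ge_atTop (1 : ℝ))))).exists
  have hx0 : 0 < x := by linarith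
  have hlev : ⌊x ^ θ⌋₊ ≤ ⌊x⌋₊ + 1 :=
    (Nat.floor_le_floor (by simpa using Real.rpow_le_rpow_of_exponent_le hx1 hθ1)).trans
      (Nat.le_succ _)
  have h1 := sub_one_le_sum_primeAPError x hlev
  rw [Real.norm_eq_abs, Real.norm_eq_abs, abs_of_nonneg (Real.rpow_nonneg hx0.le _),
    abs_of_nonneg (sum_nonneg fun q _ => primeAPError_nonneg x q)] at hbd
  have h2 : x ^ θ - 2 ≤ C * x ^ (1 - δ) := by
    have := Nat.lt_floor_add_one (x ^ θ)
    linarith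
  have h4 : x ^ θ = x ^ (1 - δ) * x ^ (θ - (1 - δ)) := by
    rw [← Real.rpow_add hx0]; ring_nf
  have h5 : (C + 1) * x ^ (1 - δ) ≤ x ^ θ := by
    rw [h4, mul_comm]
    exact mul_le_mul_of_nonneg_left hbig (Real.rpow_nonneg hx0.le _)
  nlinarith

/-- The uniform power-saving strengthening of `EH` is false. [folklore] -/
theorem not_uniformPowerSaving :
    ¬ ∃ δ : ℝ, 0 < δ ∧ ∀ θ : ℝ, θ < 1 →
      (fun x : ℝ => ∑ q ∈ Icc 1 ⌊x ^ θ⌋₊, primeAPError x q) =O[atTop] fun x : ℝ => x ^ (1 - δ) := by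
  rintro ⟨δ, hδ, h⟩
  have hδ' : 0 < min δ 1 / 2 := by positivity
  have hδ1 : min δ 1 / 2 < 1 := by
    have := min_le_right δ 1; linarith
  refine not_isBigO_powerSaving hδ' hδ1 (θ := 1 - min δ 1 / 4) (by linarith) (by linarith) ?_
  refine (h (1 - min δ 1 / 4) (by linarith)).trans (IsBigO.of_bound 1 ?_)
  filter_upwards [eventually_ge_atTop (1 : ℝ)] with x hx
  rw [one_mul, Real.norm_eq_abs, Real.norm_eq_abs, abs_of_nonneg (Real.rpow_nonneg (by linarith) _),
    abs_of_nonneg (Real.rpow_nonneg (by linarith) _)]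
  exact Real.rpow_le_rpow_of_exponent_le hx (by linarith [min_le_left δ 1])

end Summit.Parity.GeneralizedHardyLittlewood.Theorems.EH.Negative
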